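import Summits.HodgeConjecture.HodgeConjecture.Theorems.F0P2oBorelEigenfunctionalOfJacquetModule   -- ★ N3 ⟹ N3ᵟ (B-p18 (g28) p827685)
import Summits.HodgeConjecture.HodgeConjecture.Theorems.F0P2oXThetaOwnClass                       -- ★ p05 p827560: `isIrreducible_xThetaGqs`, `isSmooth_xThetaGqs`
import Summits.HodgeConjecture.HodgeConjecture.Theorems.F0P2nFrobeniusFunctional                 -- ★ p01 J2: `exists_intertwiningMap_cmPrincipalSeries_xi_of_functional`
import Literature.NumberTheory.Automorphic.UnitaryGroupPrincipalSeriesExponents                    -- ★ `cmTorusCharPair`, `cmWeylTorusCharPair`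
import Literature.NumberTheory.Automorphic.CMXiTorusCharSplitTorusDecay                           -- ★ `exists_map_eq_unitModulusChar_lt_one`
import Literature.NumberTheory.Automorphic.CMLocalRingModulusContinuous                           -- ★ `continuous_quotConj`, `continuous_halfModulusChar_apply`
import Literature.NumberTheory.Automorphic.TorusCharacterLocalComponents                          -- ★ `continuous_semilocalComponent`
import Literature.NumberTheory.Rogawski1990.GlobalAPacketMembership                                -- ★ `exists_formCongr_eq_smul_antidiag`
import Literature.NumberTheory.Automorphic.Liu2021.LemD1Item3AtVOfSeparation                       -- ★ `AreIsomorphicRep.of_comp_surjective`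
import Literature.NumberTheory.Automorphic.IdeleClassCharacterHecke                               -- ★ `isUnitary_toHeckeCharacter`
import HarnessLib

/-!
# Crux `H413`, programme P2 — road (T) «UP THE TOWER»: the ASSEMBLY (1)–(5) ⟹ ‹U1-DISJOINT› (pay-down of the U1 letter)

Cell hodgecm-mathlib (D-0151), FLOOR 0, crux H413 = stmt-HodgeConjecture-24833; lead B-p18 (g28).  Road (T) (F0P2-p01 (g7) 15:44:49Z, desk-booked
15:45:07Z) retires the print letter U1 ★ `GelbartRogawski1991.u1ThetaDichotomy_nonsplit` ([HarrisKudlaSweet1996 Cor. 4.4]; INVENTORY row III-43) onto letters already on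
the books: A-p12 (g16)'s step (6) ★ `F0P2oU1DichotomyOfDisjoint.u1ThetaDichotomy_nonsplit_of_disjoint (hdisj)` derives the letter from ‹U1-DISJOINT› = «at a non-split `v`,
a continuous character `ψ` of `E¹_v` does NOT occur in both rank-one Weil representations `ω¹_{ε₁}`, `ω¹_{ε₂}` when `ε₂/ε₁` is not a local norm»; THIS FILE produces `hdisj`
from (1) GLOBALISATION of `ψ` to a centre character `χ_f` (binder `h1`, F0P2-p01), (2) the Borel eigenfunctionals of the two theta types `X_v(μ, εᵢ, χ_f)` with THE SAME weight
`χθʷ` (★ N3 ⟹ N3ᵟ, p827685, under the N3 letter `hN3`), (3) Frobenius ★ J2 + irreducibility ★ K1c ⇒ two NON-ZERO maps of IRREDUCIBLE smooth representations into `i_G(χθʷ)`,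
(4) SUB-UNIQUENESS in `i_G(χ)` for `χ ≠ wχ` (binder `h4`, F0P2-p01 over letter N1), (5) RANK-3 LINE RIGIDITY of the theta types (binder `h5`, F0P2-p05 over ★ IV-4c1) — and the
in-house facts `χθʷ ≠ w·χθʷ` (a `σ`-fixed unit of module `< 1`, ★ `exists_map_eq_unitModulusChar_lt_one`) and continuity of `χ₁θʷ`.  THEOREMS ONLY; conditional on the named
fact `hN3` and on the three road binders `h1`, `h4`, `h5` (texts fixed on the P2 bus 16:23:35Z ∕ 16:04:51Z), nothing else.
HC_CM is proved only modulo the printed citations until rung 0 closes; nothing here proves a letter by itself.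

## References
* [GelbartRogawski1991] Invent. Math. 105: §3.2 (3.2.1)–(3.2.2) p. 457; §5.1 Lem. 5.1.2; §5.2 p. 467; Remark p. 466.  [HarrisKudlaSweet1996] JAMS 9: Cor. 4.4 p. 962.
* [Rogawski1990] Ann. of Math. Stud. 123: §12.1 p. 172, §12.2 pp. 173–174.  [Casselman1995] §6.3, §7.1.  [BernsteinZelevinsky1977] §2.3, Thm. 2.9.
* [MoeglinVignerasWaldspurger1987] Chap. 3 §IV.4.  [Kudla1986] Invent. Math. 83: Thm. 2.8.  [Liu2021] App. D Lemma D.1.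
-/

set_option autoImplicit false
-- the mandated namespace has the single-problem summit's repeated segment (`HodgeConjecture.HodgeConjecture`)
set_option linter.dupNamespace false

noncomputable section

open NumberField IsDedekindDomain MeasureTheory
open scoped Matrix NNReal

open Literature.NumberTheory Literature.NumberTheory.Automorphic Literature.NumberTheory.Automorphic.UnitaryGroup
open Literature.NumberTheory.Automorphic.IdeleClassGroup
open Literature.NumberTheory.Automorphic.Liu2021 Literature.NumberTheory.Automorphic.Liu2021.Def411WeilCarriers
open Literature.NumberTheory.GaloisRepresentations
open Literature.NumberTheory.Rogawski1990
open Literature.NumberTheory.GelbartRogawski1991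

namespace Summit.HodgeConjecture.HodgeConjecture.Cruxes.H413.F0P2oU1DisjointOfTower

/-! ## §1 The frame `dV = (1, −1, d)` with Witt kernel line `⟨d⟩`, and transport of «occurs» along equal lines -/

section Frame

variable {L : Type} [Field L] [NumberField L] [IsCMField L]

/-- «`ψ` occurs in `ω¹`» is transported along an equality of the presenting line (the proofs of reality ∕ non-vanishing are irrelevant).
[cite: GelbartRogawski1991, Remark p. 466] -/
theorem occursInLineWeilCM_of_eq {n₀ : ℕ} (e₀ : Fin 1 × Fin 1 ≃ Fin n₀) {dL dL' : Fin 1 → L} (h : dL = dL')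
    (hdL : ∀ i, IsCMField.complexConj L (dL i) = dL i) (hdL0 : ∀ i, dL i ≠ 0)
    (hdL' : ∀ i, IsCMField.complexConj L (dL' i) = dL' i) (hdL0' : ∀ i, dL' i ≠ 0)
    (μ : Literature.NumberTheory.Automorphic.IdeleClassGroup L →ₜ* Circle) (hμ : IsConjugateSymplectic L μ)
    (ε : (↥(maximalRealSubfield L))ˣ) (v : HeightOneSpectrum (𝓞 ↥(maximalRealSubfield L)))
    (ψ : ↥(normOneUnits (conjLocal L (IsCMField.complexConj L) v)) →* ℂˣ) :
    OccursInLineWeilCM L e₀ dL hdL hdL0 μ hμ ε v ψ → OccursInLineWeilCM L e₀ dL' hdL' hdL0' μ hμ ε v ψ := by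
  subst h
  exact id

omit [NumberField L] [IsCMField L] in
/-- The Witt kernel line of the frame `(1, −1, d)` is `⟨d⟩`: `−(1 · (−1) · d) = d`. [cite: Jacobowitz1962, Thm. 3.1] -/
theorem kernelLineCM_frame (dL : Fin 1 → L) : kernelLineCM (![1, -1, dL 0] : Fin 3 → L) = dL := by
  funext i
  rw [Subsingleton.elim i 0, kernelLineCM]
  simp only [Matrix.cons_val_zero, Matrix.cons_val_one, Matrix.head_cons, Matrix.cons_val_two, Matrix.tail_cons]
  ring

/-- The frame `(1, −1, d)` is real when `d` is. [cite: Jacobowitz1962, Thm. 3.1] -/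
theorem complexConj_frame (dL : Fin 1 → L) (hdL : ∀ i, IsCMField.complexConj L (dL i) = dL i) (i : Fin 3) :
    IsCMField.complexConj L ((![1, -1, dL 0] : Fin 3 → L) i) = (![1, -1, dL 0] : Fin 3 → L) i := by
  fin_cases i
  · simp
  · simp
  · simpa using hdL 0

omit [NumberField L] [IsCMField L] in
/-- The frame `(1, −1, d)` is non-degenerate when `d ≠ 0`. [cite: Jacobowitz1962, Thm. 3.1] -/
theorem frame_ne_zero (dL : Fin 1 → L) (hdL0 : ∀ i, dL i ≠ 0) (i : Fin 3) : (![1, -1, dL 0] : Fin 3 → L) i ≠ 0 := by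
  fin_cases i
  · simp
  · simp
  · simpa using hdL0 0

/-- A real diagonal form is hermitian: `(c̄ (diag dV))ᵀ = diag dV`. [cite: Mok2014, §1 Notation p. 5] -/
theorem diagonal_isHermitian (dV : Fin 3 → L) (hdV : ∀ i, IsCMField.complexConj L (dV i) = dV i) :
    ((Matrix.diagonal dV).map (cmConjRingHom L))ᵀ = Matrix.diagonal dV := by
  rw [Matrix.diagonal_map (map_zero _), Matrix.diagonal_transpose]
  exact congrArg Matrix.diagonal (funext fun i => hdV i)

omit [NumberField L] [IsCMField L] in
/-- A diagonal form with non-zero entries is non-degenerate. [cite: Mok2014, §1 Notation p. 5] -/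
theorem isUnit_det_diagonal (dV : Fin 3 → L) (hdV0 : ∀ i, dV i ≠ 0) : IsUnit (Matrix.diagonal dV).det := by
  rw [Matrix.det_diagonal, isUnit_iff_ne_zero]
  exact Finset.prod_ne_zero_iff.2 fun i _ => hdV0 i

/-- The identity frame: `(c̄ 1)ᵀ · diag dV · 1 = diag dV`. [cite: Mok2014, §1 Notation p. 5] -/
theorem one_frame (dV : Fin 3 → L) :
    (((1 : GL (Fin 3) L) : Matrix (Fin 3) (Fin 3) L).map (cmConjRingHom L))ᵀ * Matrix.diagonal dV * ((1 : GL (Fin 3) L) : Matrix (Fin 3) (Fin 3) L) =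
      Matrix.diagonal dV := by
  rw [Units.val_one, Matrix.map_one (cmConjRingHom L) (map_zero _) (map_one _), Matrix.transpose_one, Matrix.one_mul, Matrix.mul_one]

end Frame

/-! ## §2 The character `χ₁θʷ = (ψ⁻¹ ∘ quotConj)·(μ_v·(‖·‖^{1/2})⁻²)·‖·‖^{1/2}`: continuity, and `χθʷ ≠ w·χθʷ` -/

section Character

variable (L : Type) [Field L] [NumberField L] [IsCMField L] (v : HeightOneSpectrum (𝓞 ↥(maximalRealSubfield L)))

/-- A `ℂˣ`-valued map is continuous as soon as its `ℂ`-values are (the inverse is `z ↦ z⁻¹` on `ℂ ∖ 0`). [folklore] -/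
theorem continuous_units_of_coe {X : Type*} [TopologicalSpace X] (f : X → ℂˣ) (hf : Continuous fun x => ((f x : ℂˣ) : ℂ)) :
    Continuous f := by
  refine Units.continuous_iff.2 ⟨hf, ?_⟩
  simp only [Units.val_inv_eq_inv_val]
  exact hf.inv₀ fun x => (f x).ne_zero

/-- **`χ₁θʷ` is continuous** (`ψ` continuous; ★ `continuous_quotConj`, ★ `continuous_semilocalComponent`, ★ `continuous_halfModulusChar_apply`).
[cite: Rogawski1990, §12.1 p. 172] -/
theorem continuous_chiOne_thetaW (μ : Literature.NumberTheory.Automorphic.IdeleClassGroup L →ₜ* Circle)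
    (ψ : ↥(normOneUnits (conjLocal L (IsCMField.complexConj L) v)) →* ℂˣ) (hψ : Continuous fun β => ((ψ β : ℂˣ) : ℂ)) :
    Continuous fun x => ((((ψ⁻¹).comp (quotConj (conjLocal L (IsCMField.complexConj L) v) (conjLocal_conjLocal_cm L v)) *
        ((toHeckeCharacter L μ).semilocalComponent L v * (halfModulusChar (UnitaryGroup.LocalRing L v) ^ 2)⁻¹) *
        halfModulusChar (UnitaryGroup.LocalRing L v)) x : ℂˣ) : ℂ) := by
  have hψu : Continuous (ψ : ↥(normOneUnits (conjLocal L (IsCMField.complexConj L) v)) → ℂˣ) := continuous_units_of_coe _ hψ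
  have hq : Continuous (quotConj (conjLocal L (IsCMField.complexConj L) v) (conjLocal_conjLocal_cm L v)) :=
    continuous_quotConj _ (conjLocal_conjLocal_cm L v) (continuous_conjLocal L (IsCMField.complexConj L) v)
  have hμc : Continuous ((toHeckeCharacter L μ).semilocalComponent L v) := continuous_semilocalComponent L (toHeckeCharacter L μ)
  have hh : Continuous (halfModulusChar (UnitaryGroup.LocalRing L v)) := continuous_units_of_coe _ (continuous_halfModulusChar_apply L v)
  have hc : Continuous fun x : (UnitaryGroup.LocalRing L v)ˣ =>
      (ψ (quotConj (conjLocal L (IsCMField.complexConj L) v) (conjLocal_conjLocal_cm L v) x))⁻¹ *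
        ((toHeckeCharacter L μ).semilocalComponent L v x * (halfModulusChar (UnitaryGroup.LocalRing L v) x ^ 2)⁻¹) *
        halfModulusChar (UnitaryGroup.LocalRing L v) x :=
    (((hψu.comp hq).inv).mul (hμc.mul (hh.pow 2).inv)).mul hh
  refine Units.continuous_val.comp (hc.congr fun x => ?_)
  simp only [MonoidHom.mul_apply, MonoidHom.inv_apply, MonoidHom.comp_apply, MonoidHom.pow_apply]

set_option maxHeartbeats 1600000 in
/-- **`χθʷ ≠ w·χθʷ` on the torus of `U(Φ₃)(L⁺_v)`**: at the diagonal element `d(a, 1, a⁻¹)` with `a` a `σ`-fixed unit of module `‖a‖ < 1`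
(★ `exists_map_eq_unitModulusChar_lt_one`; `d(a,1,a⁻¹) ∈ U(Φ₃)` by ★ `glDiagonal_mem_unitaryGroupOfForm`), `χθʷ` takes the value `μ_v(a)‖a‖^{-1/2}` and
`w·χθʷ` the value `(μ_v(a)‖a‖^{-1/2})⁻¹`; these differ since `|μ_v(a)| = 1` (★ `isUnitary_toHeckeCharacter`) and `‖a‖ ≠ 1`.  (`χθʷ` in the pair currency:
`cmTorusCharPair L v χ₁θʷ ψ`, its Weyl conjugate ★ `cmWeylTorusCharPair`.) [cite: Rogawski1990, §12.2 pp. 173–174] [cite: Casselman1995, §7.1] -/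
theorem cmTorusCharPair_thetaW_ne_weyl (μ : Literature.NumberTheory.Automorphic.IdeleClassGroup L →ₜ* Circle)
    (ψ : ↥(normOneUnits (conjLocal L (IsCMField.complexConj L) v)) →* ℂˣ) :
    cmTorusCharPair L v
        ((ψ⁻¹).comp (quotConj (conjLocal L (IsCMField.complexConj L) v) (conjLocal_conjLocal_cm L v)) *
          ((toHeckeCharacter L μ).semilocalComponent L v * (halfModulusChar (UnitaryGroup.LocalRing L v) ^ 2)⁻¹) *
          halfModulusChar (UnitaryGroup.LocalRing L v)) ψ ≠
      cmWeylTorusCharPair L v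
        ((ψ⁻¹).comp (quotConj (conjLocal L (IsCMField.complexConj L) v) (conjLocal_conjLocal_cm L v)) *
          ((toHeckeCharacter L μ).semilocalComponent L v * (halfModulusChar (UnitaryGroup.LocalRing L v) ^ 2)⁻¹) *
          halfModulusChar (UnitaryGroup.LocalRing L v)) ψ := by
  -- a `σ`-fixed unit `a` with `‖a‖ < 1`, and the torus element `t₀ = d(a, 1, a⁻¹)`
  obtain ⟨a, haσ, ha⟩ := exists_map_eq_unitModulusChar_lt_one L v (conjLocal L (IsCMField.complexConj L) v)
  have hmem : glDiagonal 3 (UnitaryGroup.LocalRing L v) ![a, 1, a⁻¹] ∈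
      unitaryGroupOfForm (conjLocal L (IsCMField.complexConj L) v) (cmLocalForm L 3 v) := by
    rw [cmLocalForm_eq_over]
    exact F0P2nBorelCharactersUnipotent.glDiagonal_mem_unitaryGroupOfForm (conjLocal L (IsCMField.complexConj L) v) a haσ
  let t₀ : ↥(torusU (conjLocal L (IsCMField.complexConj L) v) (cmLocalForm L 3 v)) :=
    ⟨⟨glDiagonal 3 (UnitaryGroup.LocalRing L v) ![a, 1, a⁻¹], hmem⟩, (mem_torusU_iff _).2 ⟨![a, 1, a⁻¹], rfl⟩⟩
  have ht₀ : torusEntry (conjLocal L (IsCMField.complexConj L) v) (cmLocalForm L 3 v) 0 t₀ = a :=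
    torusEntry_eq_of_glDiagonal_eq _ _ 0 t₀ ![a, 1, a⁻¹] rfl
  have haσ' : Units.map (conjLocal L (IsCMField.complexConj L) v : UnitaryGroup.LocalRing L v →* UnitaryGroup.LocalRing L v) a = a :=
    Units.ext haσ
  have hq : quotConj (conjLocal L (IsCMField.complexConj L) v) (conjLocal_conjLocal_cm L v) a = 1 := by
    apply Subtype.ext
    rw [coe_quotConj, haσ', mul_inv_cancel]
    rfl
  intro heq
  have h := DFunLike.congr_fun heq t₀
  rw [cmTorusCharPair, cmWeylTorusCharPair, torusCharPair_apply, weylTorusCharPair_apply, ht₀, haσ', mul_left_inj] at h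
  -- `h : χ₁θʷ a = (χ₁θʷ a)⁻¹`; compute `χ₁θʷ a = μ_v(a) · ‖a‖⁻¹ · ‖a‖^{1/2}`
  simp only [MonoidHom.mul_apply, MonoidHom.inv_apply, MonoidHom.comp_apply, MonoidHom.pow_apply, hq, map_one, one_mul] at h
  -- norms: `|μ_v(a)| = 1`, `|‖a‖^{1/2}| = √‖a‖`
  have hμ1 : ‖(((toHeckeCharacter L μ).semilocalComponent L v a : ℂˣ) : ℂ)‖ = 1 := by
    rw [semilocalComponent_apply]
    exact isUnitary_toHeckeCharacter L μ _
  have hhc : (((halfModulusChar (UnitaryGroup.LocalRing L v) a : ℂˣ) : ℂ)) =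
      ((NNReal.sqrt (unitModulusChar (UnitaryGroup.LocalRing L v) a) : ℝ≥0) : ℝ) := coe_halfModulusChar_apply _ a
  have hs0 : 0 < NNReal.sqrt (unitModulusChar (UnitaryGroup.LocalRing L v) a) :=
    NNReal.sqrt_pos.2 (distribHaarChar_pos (A := UnitaryGroup.LocalRing L v) (g := a))
  have hs1 : NNReal.sqrt (unitModulusChar (UnitaryGroup.LocalRing L v) a) < 1 := by
    rw [← NNReal.sqrt_one]; exact NNReal.sqrt_lt_sqrt.2 ha
  -- take norms in `h`
  have hn := congrArg (fun z : ℂˣ => ‖(z : ℂ)‖) h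
  simp only [Units.val_mul, Units.val_inv_eq_inv_val, Units.val_pow_eq_pow_val, norm_mul, norm_inv, norm_pow, hμ1, one_mul, hhc,
    Complex.norm_real, Real.norm_eq_abs, NNReal.abs_eq] at hn
  -- `hn : (√m ^ 2)⁻¹ * √m = ((√m ^ 2)⁻¹ * √m)⁻¹` with `0 < √m < 1`, i.e. `(√m)⁻¹ = √m`
  have hs0' : (0 : ℝ) < NNReal.sqrt (unitModulusChar (UnitaryGroup.LocalRing L v) a) := by exact_mod_cast hs0
  have hs1' : ((NNReal.sqrt (unitModulusChar (UnitaryGroup.LocalRing L v) a) : ℝ≥0) : ℝ) < 1 := by exact_mod_cast hs1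
  have key : ((NNReal.sqrt (unitModulusChar (UnitaryGroup.LocalRing L v) a) : ℝ≥0) : ℝ) ^ 2 = 1 := by
    field_simp at hn
    nlinarith [hn, hs0']
  nlinarith [key, hs0', hs1']

end Character

/-! ## §3 The assembly -/

set_option synthInstance.maxHeartbeats 400000 in
set_option maxHeartbeats 16000000 in
/-- **‹U1-DISJOINT› FROM THE TOWER** (road (T), steps (1)–(5)): at a non-split `v`, a continuous character `ψ` of `E¹_v` does not occur in both `ω¹_{ε₁}` and `ω¹_{ε₂}`
when `ε₂/ε₁ ∉ N(L_wˣ)`.  Proof.  Frame `dV = (1, −1, d)` (`kernelLineCM dV = dL`), `H = diag dV`, `g = 1`, a form congruence `(T, a, h)` to `a·Φ₃` (★ `exists_formCongr_eq_smul_antidiag`).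
(1) `h1`: a continuous unitary `χ_f` on `E¹(𝔸_f)` with `IsThetaCenterChar L μ χf ε v ψ` for every `ε`.  (2) ★ N3 ⟹ N3ᵟ (`hN3`): occurrence of `ψ` in `ω¹_{εᵢ}` gives a non-zero
`(B, χθʷ·δ^{1/2})`-eigenfunctional on `X_v(μ, εᵢ, χ_f)` read on `U(Φ₃)(L⁺_v)`, with THE SAME `χθʷ` for `i = 1, 2`.  (3) ★ J2 Frobenius: non-zero `Φᵢ : X^{εᵢ} → i_G(χθʷ)`, sources
irreducible and smooth (★ K1c).  (4) `h4`: since `χθʷ ≠ w·χθʷ` (§2) and `χ₁θʷ, ψ` are continuous, `X^{ε₁} ≅ X^{ε₂}` on `U(Φ₃)(L⁺_v)`, hence on `U(diag dV)(L⁺_v)` (★ `AreIsomorphicRep.of_comp_surjective`).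
(5) `h5`: isomorphic theta types force `ε₂/ε₁` to be a norm — contradiction.
[cite: GelbartRogawski1991, §5.2 p. 467; Remark p. 466] [cite: HarrisKudlaSweet1996, Cor. 4.4 p. 962] [cite: Rogawski1990, §12.2 pp. 173–174] [cite: Casselman1995, §6.3] -/
theorem u1Disjoint_of_letters
    (hN3 : Literature.NumberTheory.GelbartRogawski1991.thetaType_nonsplit_jacquetModule)
    (h1 : ∀ (L : Type) [Field L] [NumberField L] [IsCMField L] (μ : Literature.NumberTheory.Automorphic.IdeleClassGroup L →ₜ* Circle)
      (hμ : IsConjugateSymplectic L μ) (v : HeightOneSpectrum (𝓞 ↥(maximalRealSubfield L))),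
      (∀ w : PlacesOver L v, IsCMField.complexConj L • w.1 = w.1) →
      ∀ (ψ : ↥(normOneUnits (conjLocal L (IsCMField.complexConj L) v)) →* ℂˣ), (Continuous fun β => ((ψ β : ℂˣ) : ℂ)) →
        ∃ χf : UnitaryGroup.finAdelicOne (↥(maximalRealSubfield L)) L (IsCMField.complexConj L) →* ℂˣ,
          Continuous χf ∧ (∀ z, ‖((χf z : ℂˣ) : ℂ)‖ = 1) ∧ ∀ ε : (↥(maximalRealSubfield L))ˣ, IsThetaCenterChar L μ χf ε v ψ)
    (h4 : ∀ (L : Type) [Field L] [NumberField L] [IsCMField L] (v : HeightOneSpectrum (𝓞 ↥(maximalRealSubfield L))),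
      (∀ w : PlacesOver L v, IsCMField.complexConj L • w.1 = w.1) →
      ∀ (χ₁ : (UnitaryGroup.LocalRing L v)ˣ →* ℂˣ) (χ₂ : ↥(normOneUnits (conjLocal L (IsCMField.complexConj L) v)) →* ℂˣ),
        (Continuous fun x => ((χ₁ x : ℂˣ) : ℂ)) → (Continuous fun x => ((χ₂ x : ℂˣ) : ℂ)) →
        cmTorusCharPair L v χ₁ χ₂ ≠ cmWeylTorusCharPair L v χ₁ χ₂ →
        ∀ {V₁ V₂ : Type} [AddCommGroup V₁] [Module ℂ V₁] [AddCommGroup V₂] [Module ℂ V₂]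
          (π₁ : Representation ℂ (Gqs L v) V₁) (π₂ : Representation ℂ (Gqs L v) V₂),
          π₁.IsIrreducible → π₁.IsSmooth → π₂.IsIrreducible → π₂.IsSmooth →
          haveI := locallyCompactSpace_cmBorelU L 3 v
          ∀ (Φ₁ : π₁.IntertwiningMap (cmPrincipalSeries L 3 v (cmTorusCharPair L v χ₁ χ₂)))
            (Φ₂ : π₂.IntertwiningMap (cmPrincipalSeries L 3 v (cmTorusCharPair L v χ₁ χ₂))),
            Φ₁ ≠ 0 → Φ₂ ≠ 0 → AreIsomorphicRep π₁ π₂)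
    (h5 : ∀ (L : Type) [Field L] [NumberField L] [IsCMField L] (dV : Fin 3 → L) (hdV : ∀ i, IsCMField.complexConj L (dV i) = dV i)
      (hdV0 : ∀ i, dV i ≠ 0) (μ : Literature.NumberTheory.Automorphic.IdeleClassGroup L →ₜ* Circle) (hμ : IsConjugateSymplectic L μ)
      (χf : UnitaryGroup.finAdelicOne (↥(maximalRealSubfield L)) L (IsCMField.complexConj L) →* ℂˣ),
      Continuous χf → (∀ z, ‖((χf z : ℂˣ) : ℂ)‖ = 1) →
      ∀ (v : HeightOneSpectrum (𝓞 ↥(maximalRealSubfield L))), (∀ w : PlacesOver L v, IsCMField.complexConj L • w.1 = w.1) →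
        ∀ (ε₁ ε₂ : (↥(maximalRealSubfield L))ˣ),
          AreIsomorphicRep (xThetaCM L (Equiv.prodUnique (Fin 3) (Fin 1)) dV hdV hdV0 μ hμ χf ε₁ v)
            (xThetaCM L (Equiv.prodUnique (Fin 3) (Fin 1)) dV hdV hdV0 μ hμ χf ε₂ v) →
          ∃ x : (UnitaryGroup.LocalRing L v)ˣ, (x : UnitaryGroup.LocalRing L v) * conjLocal L (IsCMField.complexConj L) v x =
            algebraMap L (UnitaryGroup.LocalRing L v) (((ε₂ * ε₁⁻¹ : (↥(maximalRealSubfield L))ˣ) : ↥(maximalRealSubfield L)) : L)) :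
    ∀ (L : Type) [Field L] [NumberField L] [IsCMField L] {n₀ : ℕ} (e₀ : Fin 1 × Fin 1 ≃ Fin n₀) (dL : Fin 1 → L)
      (hdL : ∀ i, IsCMField.complexConj L (dL i) = dL i) (hdL0 : ∀ i, dL i ≠ 0)
      (μ : Literature.NumberTheory.Automorphic.IdeleClassGroup L →ₜ* Circle) (hμ : IsConjugateSymplectic L μ)
      (v : HeightOneSpectrum (𝓞 ↥(maximalRealSubfield L))), (∀ w : PlacesOver L v, IsCMField.complexConj L • w.1 = w.1) →
      ∀ (ψ : ↥(normOneUnits (conjLocal L (IsCMField.complexConj L) v)) →* ℂˣ), (Continuous fun β => ((ψ β : ℂˣ) : ℂ)) →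
      ∀ (ε₁ ε₂ : (↥(maximalRealSubfield L))ˣ),
        (¬ ∃ x : (UnitaryGroup.LocalRing L v)ˣ, (x : UnitaryGroup.LocalRing L v) * conjLocal L (IsCMField.complexConj L) v x =
          algebraMap L (UnitaryGroup.LocalRing L v) (((ε₂ * ε₁⁻¹ : (↥(maximalRealSubfield L))ˣ) : ↥(maximalRealSubfield L)) : L)) →
        ¬ (OccursInLineWeilCM L e₀ dL hdL hdL0 μ hμ ε₁ v ψ ∧ OccursInLineWeilCM L e₀ dL hdL hdL0 μ hμ ε₂ v ψ) := by
  intro L _ _ _ n₀ e₀ dL hdL hdL0 μ hμ v hv ψ hψ ε₁ ε₂ hnn hocc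
  -- the frame
  have hdV := complexConj_frame dL hdL
  have hdV0 := frame_ne_zero dL hdL0
  have hocc₁ := occursInLineWeilCM_of_eq e₀ (kernelLineCM_frame dL).symm hdL hdL0 (complexConj_kernelLineCM _ hdV)
    (kernelLineCM_ne_zero _ hdV0) μ hμ ε₁ v ψ hocc.1
  have hocc₂ := occursInLineWeilCM_of_eq e₀ (kernelLineCM_frame dL).symm hdL hdL0 (complexConj_kernelLineCM _ hdV)
    (kernelLineCM_ne_zero _ hdV0) μ hμ ε₂ v ψ hocc.2
  have hH := diagonal_isHermitian (![1, -1, dL 0] : Fin 3 → L) hdV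
  have hHd := isUnit_det_diagonal (![1, -1, dL 0] : Fin 3 → L) hdV0
  have hg := one_frame (![1, -1, dL 0] : Fin 3 → L)
  obtain ⟨T, a, ha, h⟩ := Literature.NumberTheory.Rogawski1990.exists_formCongr_eq_smul_antidiag hH hHd v hv
  haveI := locallyCompactSpace_cmBorelU L 3 v
  -- (1) globalise `ψ`
  obtain ⟨χf, hcont, hunit, hspec⟩ := h1 L μ hμ v hv ψ hψ
  -- (2) the two eigenfunctionals with the same weight `χθʷ`
  obtain ⟨ℓ₁, hℓ₁0, hℓ₁⟩ := F0P2oBorelEigenfunctionalOfJacquetModule.thetaType_nonsplit_borelEigenfunctional_of_jacquetModule hN3 L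
    (Matrix.diagonal ![1, -1, dL 0]) hH hHd (Equiv.prodUnique (Fin 3) (Fin 1)) ![1, -1, dL 0] hdV hdV0 1 hg e₀ μ hμ χf hcont hunit
    v hv T a ha h ε₁ ψ (hspec ε₁) hocc₁
  obtain ⟨ℓ₂, hℓ₂0, hℓ₂⟩ := F0P2oBorelEigenfunctionalOfJacquetModule.thetaType_nonsplit_borelEigenfunctional_of_jacquetModule hN3 L
    (Matrix.diagonal ![1, -1, dL 0]) hH hHd (Equiv.prodUnique (Fin 3) (Fin 1)) ![1, -1, dL 0] hdV hdV0 1 hg e₀ μ hμ χf hcont hunit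
    v hv T a ha h ε₂ ψ (hspec ε₂) hocc₂
  -- (3) Frobenius: non-zero maps into `i_G(χθʷ)` from the irreducible smooth `X^{εᵢ}`
  have hirr₁ := F0P2oXThetaOwnClass.isIrreducible_xThetaGqs L (Matrix.diagonal ![1, -1, dL 0]) (Equiv.prodUnique (Fin 3) (Fin 1))
    ![1, -1, dL 0] hdV hdV0 1 hg μ hμ χf hcont hunit ε₁ v T a ha h
  have hsm₁ := F0P2oXThetaOwnClass.isSmooth_xThetaGqs L (Matrix.diagonal ![1, -1, dL 0]) (Equiv.prodUnique (Fin 3) (Fin 1))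
    ![1, -1, dL 0] hdV hdV0 1 hg μ hμ χf hcont hunit ε₁ v T a ha h
  have hirr₂ := F0P2oXThetaOwnClass.isIrreducible_xThetaGqs L (Matrix.diagonal ![1, -1, dL 0]) (Equiv.prodUnique (Fin 3) (Fin 1))
    ![1, -1, dL 0] hdV hdV0 1 hg μ hμ χf hcont hunit ε₂ v T a ha h
  have hsm₂ := F0P2oXThetaOwnClass.isSmooth_xThetaGqs L (Matrix.diagonal ![1, -1, dL 0]) (Equiv.prodUnique (Fin 3) (Fin 1))
    ![1, -1, dL 0] hdV hdV0 1 hg μ hμ χf hcont hunit ε₂ v T a ha h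
  obtain ⟨Φ₁, hΦ₁, -⟩ := F0P2nFrobeniusFunctional.exists_intertwiningMap_cmPrincipalSeries_xi_of_functional L v
    ((toHeckeCharacter L μ).semilocalComponent L v * ((halfModulusChar (UnitaryGroup.LocalRing L v)) ^ 2)⁻¹) ψ⁻¹ ψ _ hsm₁ ℓ₁ hℓ₁ hℓ₁0
  obtain ⟨Φ₂, hΦ₂, -⟩ := F0P2nFrobeniusFunctional.exists_intertwiningMap_cmPrincipalSeries_xi_of_functional L v
    ((toHeckeCharacter L μ).semilocalComponent L v * ((halfModulusChar (UnitaryGroup.LocalRing L v)) ^ 2)⁻¹) ψ⁻¹ ψ _ hsm₂ ℓ₂ hℓ₂ hℓ₂0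
  -- (4) sub-uniqueness in `i_G(χθʷ)`, `χθʷ ≠ w·χθʷ`
  have hiso := h4 L v hv _ ψ (continuous_chiOne_thetaW L v μ ψ hψ) hψ (cmTorusCharPair_thetaW_ne_weyl L v μ ψ)
    _ _ hirr₁ hsm₁ hirr₂ hsm₂ Φ₁ Φ₂ hΦ₁ hΦ₂
  -- descend from `U(Φ₃)(L⁺_v)` to `U(diag dV)(L⁺_v)` along the common (surjective) congruences
  have hiso' := AreIsomorphicRep.of_comp_surjective _
    ((cmDatumLocalCongr L v T ha h).trans (localPiEquiv L (IsCMField.complexConj L) 3 (Matrix.diagonal ![1, -1, dL 0]) v).symm).surjective hiso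
  have hiso'' := AreIsomorphicRep.of_comp_surjective _
    (localCongr L (IsCMField.complexConj L) (1 : GL (Fin 3) L) one_ne_zero (by rw [one_smul]; exact hg) v).symm.surjective hiso'
  -- (5) line rigidity
  exact hnn (h5 L ![1, -1, dL 0] hdV hdV0 μ hμ χf hcont hunit v hv ε₁ ε₂ hiso'')

end Summit.HodgeConjecture.HodgeConjecture.Cruxes.H413.F0P2oU1DisjointOfTower

end
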